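import Literature.NumberTheory.LFunctions.SuzukiWeilChainInclusionProofs
import Literature.NumberTheory.LFunctions.SuzukiWeilChainShiftProofs
import HarnessLib

/-!
# CJM Thm. 5.7: the chain of de Branges subspaces `E_ξ𝖥(V(t)) ⊂ 𝓗(E_ξ)` — discharge of `Suzuki2025_thm57`

LINE 1 — LABEL: RH-CONSEQUENCE proof (explicit binder `RiemannHypothesis →`, never dropped) of the
printed «Assume RH» statement CJM Thm. 5.7 of the cell rh-crit/dbl (M. Suzuki, Canad. J. Math. 2025
= arXiv:2301.00421v3). bears_on: B-C/B-P (LADDER-RH COLUMN 6 DBR). WHAT THIS IS NOT: a printed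
consequence of RH formalised as such; it does not move RH; nothing here bears on the truth of RH.

## What is proved

`Suzuki2025_thm57_holds : Suzuki2025_thm57`, assembled from the cell's landed pieces: clause 1
(`E𝖥(V(t)) ⊆ 𝓗(E)`) and the kernel bound of clause 2 (dB1) from CJM Lemma 5.1 (ii)
(`SuzukiChainInclusion.mem_deBrangesSpace_of_mem_suzukiChainSpace_zero`, `norm_sq_le_kernelDiag`);
clause 3 (dB2) = `SuzukiChainInclusion.sharp_mem_suzukiChainSpace` (RH-free); clause 5 =
`suzuki2025_thm57_clause5` (RH-free); clause 4 (dB3) — the one construction — by the printed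
argument: for `Φ = Ef̂ ∈ E𝖥(V(t))` with `Φ(w) = 0`, `w ∈ ℂ₊`, the quotient `Ψ = ((z−w̄)/(z−w))Φ`
lies in `𝓗(E)` (`deBrangesSpace_blaschke_mem`), hence `Ψ = Eĝ₀` with `g₀ ∈ V(0)` (Lemma 5.1 (ii)
`⊇`); `ĝ₀ = ((z−w̄)/(z−w))f̂ = f̂_w` with Suzuki's `f_w ∈ L²(t,∞)`
(`exists_mem_halfLineL2_upperHalfHat_eq_blaschke_mul_of_im_pos`) forces `g₀ = f_w ∈ L²(t,∞)`, and
`Ψ♯ = E(𝖪g₀)^ = ((z−w)/(z−w̄))Φ♯ = ((z−w)/(z−w̄))E(𝖪f)^` with Suzuki's `g_w ∈ L²(t,∞)`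
(`…_of_im_neg`) forces `𝖪g₀ = g_w ∈ L²(t,∞)`; so `g₀ ∈ V(t)`. The case `w ∈ ℂ₋` follows through
`♯` (dB2), as printed. No definition and no named fact is introduced.

## References
* M. Suzuki, Canad. J. Math. 2025 = arXiv:2301.00421v3, Thm. 5.7 p. 16 (TeX l.1844–1950).
  [Suzuki2025WeilHilbertSpace]
-/

noncomputable section

open MeasureTheory Complex Filter Set
open scoped ComplexConjugate Topology Real ENNReal

namespace Literature.NumberTheory.LFunctions

open Literature.Analysis.DeBrangesSpaces SuzukiChainInclusion

/-- `E𝖥(V(t)) ⊆ E𝖥(V(0))` for `t ≥ 0` (`V(t) ⊆ V(0)`). RH-FREE.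
[cite: Suzuki2025WeilHilbertSpace, CJM §5 p. 13 (TeX l.1440–1447: "V(t) ⊃ V(u) for t < u")] -/
theorem suzukiChainSpace_subset_zero {t : ℝ} (ht : 0 ≤ t) :
    suzukiChainSpace t ⊆ suzukiChainSpace 0 := by
  rintro Φ ⟨hΦd, f, hf, hΦf⟩
  exact ⟨hΦd, f, suzukiV_antitone ht hf, hΦf⟩

/-- `(♯Ψ)` of the Blaschke quotient: for `z, w` with `conj z ≠ w`,
`conj(((z̄ − w̄)·dslope Φ w z̄)) = ((z − w)/(z − w̄))·Φ♯(z)`. [folklore] -/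
private theorem sharp_blaschke_dslope {Φ : ℂ → ℂ} {w z : ℂ} (hΦw : Φ w = 0) (hz : conj z ≠ w) :
    sharp (fun u : ℂ ↦ (u - conj w) * dslope Φ w u) z = (z - w) / (z - conj w) * sharp Φ z := by
  simp only [sharp]
  rw [blaschke_dslope_apply_of_ne hΦw hz, map_mul, map_div₀, map_sub, map_sub,
    Complex.conj_conj, Complex.conj_conj]

/-- **Axiom (dB3) for `E_ξ𝖥(V(t))`, zero in the upper half-plane (under RH).** For `t ≥ 0`,
`Φ ∈ E_ξ𝖥(V(t))` and `w ∈ ℂ₊` with `Φ(w) = 0`, the entire function `(z − w̄)·dslope Φ w z`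
(`= ((z − w̄)/(z − w))Φ(z)` off `w`) lies in `E_ξ𝖥(V(t))` — Suzuki's `f_w`, `g_w`. RH-CONSEQUENCE.
[cite: Suzuki2025WeilHilbertSpace, CJM Thm. 5.7 p. 16, proof of (dB3) (TeX l.1924–1946)] -/
theorem blaschke_dslope_mem_suzukiChainSpace_of_im_pos (hRH : RiemannHypothesis) {t : ℝ}
    (ht : 0 ≤ t) {Φ : ℂ → ℂ} (hΦ : Φ ∈ suzukiChainSpace t) {w : ℂ} (hw : 0 < w.im)
    (hΦw : Φ w = 0) :
    (fun z : ℂ ↦ (z - conj w) * dslope Φ w z) ∈ suzukiChainSpace t := by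
  obtain ⟨hΦd, f, hf, hΦf⟩ := hΦ
  have hf0 : f ∈ suzukiV 0 := suzukiV_antitone ht hf
  have hft : f ∈ halfLineL2 t := (mem_suzukiV_iff.1 hf).1
  have hE : IsHermiteBiehler lagariasE := Lagarias2006_thm1_onlyif_holds hRH
  have hU : IsOpen {z : ℂ | 0 < z.im} := isOpen_lt continuous_const Complex.continuous_im
  -- `Ψ ∈ 𝓗(E)`, hence `Ψ = E ĝ₀` with `g₀ ∈ V(0)`
  have hΦH : Φ ∈ DeBrangesSpace lagariasE :=
    mem_deBrangesSpace_of_mem_suzukiChainSpace_zero hRH ⟨hΦd, f, hf0, hΦf⟩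
  set Ψ : ℂ → ℂ := fun z ↦ (z - conj w) * dslope Φ w z with hΨ
  have hΨH : Ψ ∈ DeBrangesSpace lagariasE := deBrangesSpace_blaschke_mem hE hΦH hw.ne' hΦw
  obtain ⟨hΨd, g₀, hg₀, hΨg₀⟩ := deBrangesSpace_subset_suzukiChainSpace_zero hRH hΨH
  have hg₀0 : g₀ ∈ halfLineL2 0 := (mem_suzukiV_iff.1 hg₀).1
  -- `f̂(w) = 0`
  have hEw : lagariasE w ≠ 0 := lagariasE_ne_zero_of_im_pos hRH hw
  have hfw : upperHalfHat f w = 0 := by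
    have h := hΦw
    rw [hΦf w hw] at h
    exact (mul_eq_zero.1 h).resolve_left hEw
  -- Suzuki's `f_w ∈ L²(t,∞)` with `f̂_w = (z − w̄)·dslope f̂ w`, and `ĝ₀ = f̂_w`
  obtain ⟨h, hh, hhat⟩ := exists_mem_halfLineL2_upperHalfHat_eq_blaschke_mul_of_im_pos ht hft hw hfw
  have heq' : ∀ z : ℂ, 0 < z.im → z ≠ w → upperHalfHat g₀ z = upperHalfHat h z := by
    intro z hz hzw
    have hEz : lagariasE z ≠ 0 := lagariasE_ne_zero_of_im_pos hRH hz
    have h1 : lagariasE z * upperHalfHat g₀ z = lagariasE z * upperHalfHat h z := by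
      rw [← hΨg₀ z hz, hhat z hz, blaschke_dslope_apply_of_ne hfw hzw, hΨ]
      simp only
      rw [blaschke_dslope_apply_of_ne hΦw hzw, hΦf z hz]
      ring
    exact mul_left_cancel₀ hEz h1
  have heq : ∀ z : ℂ, 0 < z.im → upperHalfHat g₀ z = upperHalfHat h z := by
    intro z hz
    by_cases hzw : z ≠ w
    · exact heq' z hz hzw
    · push Not at hzw
      subst hzw
      -- at `w`: both hats are continuous at `w` and agree on a punctured neighbourhood
      have hc₁ : ContinuousAt (upperHalfHat g₀) z :=
        ((differentiableOn_upperHalfHat g₀).differentiableAt (hU.mem_nhds hz)).continuousAt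
      have hc₂ : ContinuousAt (upperHalfHat h) z :=
        ((differentiableOn_upperHalfHat h).differentiableAt (hU.mem_nhds hz)).continuousAt
      have hev : ∀ᶠ u in 𝓝[≠] z, upperHalfHat g₀ u = upperHalfHat h u := by
        have h1 : ∀ᶠ u in 𝓝[≠] z, 0 < u.im :=
          mem_nhdsWithin_of_mem_nhds (hU.mem_nhds hz)
        filter_upwards [h1, self_mem_nhdsWithin] with u hu huz
        exact heq' u hu huz
      exact tendsto_nhds_unique_of_eventuallyEq (hc₁.tendsto.mono_left nhdsWithin_le_nhds)
        (hc₂.tendsto.mono_left nhdsWithin_le_nhds) hev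
  have hg₀h : g₀ = h := eq_of_upperHalfHat_eq hg₀0 (halfLineL2_antitone ht hh) heq
  have hg₀t : g₀ ∈ halfLineL2 t := hg₀h ▸ hh
  -- the `𝖪`-side: `Ψ♯ = E(𝖪g₀)^`, `Φ♯ = E(𝖪f)^`, `Ψ♯ = ((z−w)/(z−w̄))Φ♯`, Suzuki's `g_w`
  have hKf : suzukiK f ∈ halfLineL2 t := (mem_suzukiV_iff.1 (suzukiK_mem_suzukiV hf)).1
  have hw' : (conj w).im < 0 := by rw [Complex.conj_im]; linarith
  obtain ⟨h', hh', hhat'⟩ :=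
    exists_mem_halfLineL2_upperHalfHat_eq_blaschke_mul_of_im_neg ht hKf hw'
  have heqK : ∀ z : ℂ, 0 < z.im → upperHalfHat (suzukiK g₀) z = upperHalfHat h' z := by
    intro z hz
    have hEz : lagariasE z ≠ 0 := lagariasE_ne_zero_of_im_pos hRH hz
    have hzc : conj z ≠ w := fun e ↦ by
      have := congrArg Complex.im e
      rw [Complex.conj_im] at this
      linarith
    have h1 := sharp_eq_lagariasE_mul_upperHalfHat_suzukiK hΨd hg₀ hΨg₀ hz
    have h2 := sharp_eq_lagariasE_mul_upperHalfHat_suzukiK hΦd hf0 hΦf hz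
    have h3 : sharp Ψ z = (z - w) / (z - conj w) * sharp Φ z := sharp_blaschke_dslope hΦw hzc
    have h4 : lagariasE z * upperHalfHat (suzukiK g₀) z = lagariasE z * upperHalfHat h' z := by
      rw [← h1, h3, h2, hhat' z hz, Complex.conj_conj]
      ring
    exact mul_left_cancel₀ hEz h4
  have hKg₀ : suzukiK g₀ = h' :=
    eq_of_upperHalfHat_eq (mem_suzukiV_iff.1 (suzukiK_mem_suzukiV hg₀)).1
      (halfLineL2_antitone ht hh') heqK
  have hg₀V : g₀ ∈ suzukiV t := mem_suzukiV_iff.2 ⟨hg₀t, hKg₀ ▸ hh'⟩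
  exact ⟨hΨd, g₀, hg₀V, hΨg₀⟩

/-- **Axiom (dB3) for `E_ξ𝖥(V(t))` at any non-real zero (under RH)**; the case `w ∈ ℂ₋` is
reduced to `w̄ ∈ ℂ₊` through (dB2) (`♯`), as printed ("From (dB2), it is sufficient to show only the
case of w ∈ ℂ₊"). RH-CONSEQUENCE.
[cite: Suzuki2025WeilHilbertSpace, CJM Thm. 5.7 p. 16, proof of (dB3) (TeX l.1922–1926)] -/
theorem blaschke_dslope_mem_suzukiChainSpace (hRH : RiemannHypothesis) {t : ℝ} (ht : 0 ≤ t)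
    {Φ : ℂ → ℂ} (hΦ : Φ ∈ suzukiChainSpace t) {w : ℂ} (hw : w.im ≠ 0) (hΦw : Φ w = 0) :
    (fun z : ℂ ↦ (z - conj w) * dslope Φ w z) ∈ suzukiChainSpace t := by
  rcases lt_or_gt_of_ne hw with hneg | hpos
  · -- `w ∈ ℂ₋`: work with `Φ♯` at `w̄ ∈ ℂ₊`
    have hw' : 0 < (conj w).im := by rw [Complex.conj_im]; linarith
    have hΦs : sharp Φ ∈ suzukiChainSpace t := sharp_mem_suzukiChainSpace ht hΦ
    have hΦsw : sharp Φ (conj w) = 0 := by simp [sharp, hΦw]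
    have h1 := blaschke_dslope_mem_suzukiChainSpace_of_im_pos hRH ht hΦs hw' hΦsw
    obtain ⟨-, g, hg, hg'⟩ := sharp_mem_suzukiChainSpace ht h1
    refine ⟨differentiable_blaschke_dslope hΦ.1 w, g, hg, fun z hz ↦ ?_⟩
    -- on `ℂ₊` (where `z ≠ w`) the function is the `♯` of the `ℂ₊`-construction for `Φ♯`
    have hzw : z ≠ w := fun e ↦ by rw [e] at hz; exact absurd hz (not_lt.2 hneg.le)
    have hzc : conj z ≠ conj w := fun e ↦ hzw (by simpa using congrArg conj e)
    rw [← hg' z hz, sharp_blaschke_dslope hΦsw hzc]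
    simp only [sharp, Complex.conj_conj]
    rw [blaschke_dslope_apply_of_ne hΦw hzw]
  · exact blaschke_dslope_mem_suzukiChainSpace_of_im_pos hRH ht hΦ hpos hΦw

/-- **Discharge of `Suzuki2025_thm57` (CJM Thm. 5.7: under RH, `E_ξ𝖥(V(t))` is a de Branges
subspace of `𝓗(E_ξ)` for every `t ≥ 0`, with the Hilbert-space structure induced from `V(t)`).**
Clauses: (1) `⊆ 𝓗(E_ξ)` and (2) (dB1) from Lemma 5.1 (ii) and the kernel bound with `C = K(z,z)`;
(3) (dB2) RH-free; (4) (dB3) `blaschke_dslope_mem_suzukiChainSpace`; (5) the norm identity, RH-free.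
RH-CONSEQUENCE, PROVED. [cite: Suzuki2025WeilHilbertSpace, CJM Thm. 5.7 p. 16 (TeX l.1844–1950)] -/
theorem Suzuki2025_thm57_holds : Suzuki2025_thm57 := by
  intro hRH t ht
  refine ⟨?_, ?_, fun Φ hΦ ↦ sharp_mem_suzukiChainSpace ht hΦ, ?_, suzuki2025_thm57_clause5 ht⟩
  · exact fun Φ hΦ ↦ mem_deBrangesSpace_of_mem_suzukiChainSpace_zero hRH
      (suzukiChainSpace_subset_zero ht hΦ)
  · intro z hz
    refine ⟨deBrangesKernelDiag lagariasE z, ?_⟩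
    rintro Φ ⟨hΦd, f, hf, hΦf⟩
    have hf0 : f ∈ suzukiV 0 := suzukiV_antitone ht hf
    have h1 := norm_sq_le_kernelDiag hRH hΦd hf0 hΦf hz
    rw [deBrangesNormSq_eq_two_pi_mul_norm_sq (mem_suzukiV_iff.1 hf0).1 hΦd hΦf]
    linarith [h1]
  · intro Φ hΦ w hw hΦw
    exact ⟨_, blaschke_dslope_mem_suzukiChainSpace hRH ht hΦ hw hΦw,
      fun z hz ↦ blaschke_dslope_apply_of_ne hΦw hz⟩

end Literature.NumberTheory.LFunctions

end
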